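import Summits.QuantumFields.BalabanUV.T4Continuum.Support.NE7DcurlGaugeCovariance
import Summits.QuantumFields.BalabanUV.T4Continuum.Support.NE7ExpansionSegmentLetters
import Summits.QuantumFields.BalabanUV.T4Continuum.Support.NE3EnergySmallFieldCurl
import HarnessLib

/-!
# NE7ExpansionSegmentLettersCurved — F48a's SEGMENT LETTERS AT A CURVED BACKGROUND: the covariant curl of `A` is bounded by the COVARIANT gradient letter
# (`‖(d_W A)(p′)‖ ≤ 2α₁`, no curvature term), and along the segment `V_s = We^{sA}` the curl, the plaquette variable and the Taylor tail of the curl obey F48a's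
# flat bounds VERBATIM (`2α₁ + 24(e^{α₀}−1)α₀`, `960(e^{α₀}−1)α₀²`) — the remaining letters of the STRONG curved expansion remainder (CURVED-APE-ROAD (L5))

Cell `pub-balaban`, rung (B)+1 sub-cell t4, lineage `b2b-balaban-t4-ne7-p1` (CRUX PROVER NE7 #1 = OWNER of row NE7), generation 75.  File F64 — third brick of (L5)
after F61 `NE7CovariantByParts` (by parts) and F63 `NE7CubicVertexCurved` (the cubic vertex's covariant adjacent differences) — over F47 `NE7DcurlBaseLipschitz`, row NE3's
`NE3CurlStability` ∕ `NE3EnergySmallFieldCurl`, `NE7SegmentPlaquetteRadius.hasDerivAt_curlAt_vary_at`, F62 `NE7DcurlGaugeCovariance.dcurlAt_shift`.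

WHAT ([folklore] lattice calculus; 0 def, 0 sorry; `W` unitary; `A` skew with `‖A‖ ≤ α₀`; the FORWARD covariant gradient letter
`‖Ad_{W(y+e_κ,τ)}A(y+e_τ,κ) − A(y,κ)‖ ≤ α₁` ([B8] (1.36)₂ ∕ `PairLandauB8.LandauRepB8.grad` TYPE)):
§1 **`norm_curlAt_le_of_covGrad`** (`‖(d_W A)(z;μ,ν)‖ ≤ 2α₁`: the dressed curl is the sum of two transported covariant differences), **`covGrad_backward_of_forward`**
   (the forward letter gives F63's backward one, same `α₁`).
§2 along the segment, `s ∈ [0,1]`: `norm_vary_sub_le_W` (links within `e^{α₀}−1` of `W`'s), **`norm_curlAt_vary_le_W`** (`‖(d_{V_s}A)(p′)‖ ≤ 2α₁ + 24(e^{α₀}−1)α₀`),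
   **`norm_hol_vary_sub_hol_le_W`** (`‖V_s(∂p′) − W(∂p′)‖ ≤ 2α₁ + 24α₀(e^{α₀}−1)`), **`norm_curlAt_vary_taylor_le_W`**
   (`‖(d_{V_s}A)(p′) − (d_WA)(p′) − s·𝒬_W(A)(p′)‖ ≤ 960(e^{α₀}−1)α₀²`), `dcurlAt_self_periodic_W` (`𝒬_W(A)` periodic in the corner for periodic `W, A`).
HONEST FRAMING (page 1): lattice calculus on OUR objects; the gradient letter `α₁` is a HYPOTHESIS; nothing of Bałaban's asserted; the strong hEXP assembly (curved F48b)
and (APE) on curved data NOT proved; NOT ONE-STEP, NOT NE7; spine 0∕9; finite T⁴ rung (B)+1 — NOT infinite volume, NOT mass gap, NOT `BetaPertH`, NOT Clay.  Continuum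
YM on T⁴ ⇐ BetaPertH ∧ nine spine estimates (0/9 proved); BetaPertH ⇐ (D1) ∧ (D4) ∧ CAP+tail; G-an2-4 gates asym, D1 and NE2/3/4.
-/

set_option autoImplicit false

open scoped BigOperators Matrix.Norms.L2Operator
open NormedSpace Finset Set

namespace Summit.QuantumFields.BalabanUV.T4Continuum.NE7ExpansionSegmentLettersCurved

open Literature.MathematicalPhysics.QuantumFieldTheory.Balaban1983to89
open B7Prop1Explicit B7Prop2Explicit MatrixLog UnitaryModel
open T4AveragingDeficitWall (Ad IsUnitaryCfg IsSkewDir SmallField curlAt vary vary_zero)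
open T4AveragingDeficitWallBoundary (IsPeriodicCfg)
open T4AveragingDeficitNonAbelian (Ad_mul Ad_sub)
open AveragingDeficitPeriodicCounting (IsPeriodicDir)
open AveragingDeficitTransport (norm_Ad_of_unitary)
open AveragingDeficitPlaqDeriv (vary_isUnitaryCfg)
open NE3HessForm (dcurlAt)
open NE3HessContinuity (bondL1At bondL1At_nonneg)
open NE3CurlStability (norm_curlAt_vary_sub_le norm_vary_sub_le_of_sup)
open NE3EnergySmallFieldCurl (norm_hol_vary_sub_hol_le_curl)
open NE7CubicVertexLetters (bondL1At_le_of_sup)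
open NE7DcurlBaseLipschitz (norm_dcurlAt_sub_dcurlAt_le)
open NE7SegmentPlaquetteRadius (hasDerivAt_curlAt_vary_at)
open NE7DcurlGaugeCovariance (dcurlAt_shift)

noncomputable section

variable {d : ℕ} {n : Type*} [Fintype n] [DecidableEq n]

/-! ## §1 The dressed curl against the covariant gradient letter -/

/-- **THE DRESSED CURL IS TWO TRANSPORTED COVARIANT DIFFERENCES**: for unitary `W` and the forward covariant gradient letter `α₁`,
`‖(d_W A)(z;μ,ν)‖ ≤ 2α₁` — `d_W A = Ad_{U₁}[A(z,μ) − Ad_{U₂}A(z+e_ν,μ)] + Ad_{U₁U₂U₃⁻¹}[Ad_{U₃}A(z+e_μ,ν) − A(z,ν)]`. [folklore] -/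
theorem norm_curlAt_le_of_covGrad [Nonempty n] {W : Site d → Fin d → (Matrix n n ℂ)ˣ} (hW : IsUnitaryCfg W) {A : Site d → Fin d → Matrix n n ℂ} {α₁ : ℝ}
    (hA1 : ∀ (y : Site d) (κ τ : Fin d), ‖Ad (W (y + e κ) τ) (A (y + e τ) κ) - A y κ‖ ≤ α₁) (z : Site d) (μ ν : Fin d) :
    ‖curlAt W A z μ ν‖ ≤ 2 * α₁ := by
  have hid : curlAt W A z μ ν
      = -Ad (W z μ) (Ad (W (z + e μ) ν) (A (z + e ν) μ) - A z μ)
        + Ad (W z μ * W (z + e μ) ν * (W (z + e ν) μ)⁻¹) (Ad (W (z + e ν) μ) (A (z + e μ) ν) - A z ν) := by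
    simp only [curlAt, Ad_sub, ← Ad_mul, mul_assoc, inv_mul_cancel, mul_one]
    abel
  rw [hid]
  have hu1 : W z μ ∈ unitaryUnits (Matrix n n ℂ) := hW z μ
  have hu3 : W z μ * W (z + e μ) ν * (W (z + e ν) μ)⁻¹ ∈ unitaryUnits (Matrix n n ℂ) :=
    (unitaryUnits _).mul_mem ((unitaryUnits _).mul_mem (hW _ _) (hW _ _)) ((unitaryUnits _).inv_mem (hW _ _))
  calc _ ≤ ‖-Ad (W z μ) (Ad (W (z + e μ) ν) (A (z + e ν) μ) - A z μ)‖
        + ‖Ad (W z μ * W (z + e μ) ν * (W (z + e ν) μ)⁻¹) (Ad (W (z + e ν) μ) (A (z + e μ) ν) - A z ν)‖ := norm_add_le _ _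
    _ ≤ α₁ + α₁ := by
        rw [norm_neg, norm_Ad_of_unitary hu1, norm_Ad_of_unitary hu3]
        exact add_le_add (hA1 z μ ν) (hA1 z ν μ)
    _ = 2 * α₁ := by ring

/-- **FORWARD ⟹ BACKWARD**: the forward letter gives F63's backward one, `‖A(y,κ) − Ad_{W(y+e_κ−e_τ,τ)⁻¹}A(y−e_τ,κ)‖ ≤ α₁` (apply it at `y − e_τ` and undo the
transport, an isometry). [folklore] -/
theorem covGrad_backward_of_forward [Nonempty n] {W : Site d → Fin d → (Matrix n n ℂ)ˣ} (hW : IsUnitaryCfg W) {A : Site d → Fin d → Matrix n n ℂ} {α₁ : ℝ}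
    (hA1 : ∀ (y : Site d) (κ τ : Fin d), ‖Ad (W (y + e κ) τ) (A (y + e τ) κ) - A y κ‖ ≤ α₁) (y : Site d) (κ τ : Fin d) :
    ‖A y κ - Ad (W (y + e κ - e τ) τ)⁻¹ (A (y - e τ) κ)‖ ≤ α₁ := by
  have h := hA1 (y - e τ) κ τ
  rw [sub_add_cancel, show y - e τ + e κ = y + e κ - e τ by abel] at h
  have hid : A y κ - Ad (W (y + e κ - e τ) τ)⁻¹ (A (y - e τ) κ)
      = Ad (W (y + e κ - e τ) τ)⁻¹ (Ad (W (y + e κ - e τ) τ) (A y κ) - A (y - e τ) κ) := by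
    rw [Ad_sub, ← Ad_mul, inv_mul_cancel, AveragingDeficitNearIdentity.Ad_one]
  rw [hid, norm_Ad_of_unitary ((unitaryUnits _).inv_mem (hW _ _))]
  exact h

/-! ## §2 Along the segment `V_s = We^{sA}`, `s ∈ [0,1]` -/

/-- The links of `We^{sA}` stay within `e^{α₀} − 1` of those of `W` for `s ∈ [0,1]`. [folklore] -/
theorem norm_vary_sub_le_W [Nonempty n] {W : Site d → Fin d → (Matrix n n ℂ)ˣ} (hW : IsUnitaryCfg W) {A : Site d → Fin d → Matrix n n ℂ} {α₀ : ℝ}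
    (hAα : ∀ y κ, ‖A y κ‖ ≤ α₀) {s : ℝ} (hs : s ∈ Icc (0 : ℝ) 1) (x : Site d) (κ : Fin d) :
    ‖((vary W A s x κ : (Matrix n n ℂ)ˣ) : Matrix n n ℂ) - (W x κ : Matrix n n ℂ)‖ ≤ Real.exp α₀ - 1 := by
  have hα : 0 ≤ α₀ := (norm_nonneg _).trans (hAα x κ)
  refine (norm_vary_sub_le_of_sup hW hAα s x κ).trans ?_
  have hs1 : |s| ≤ 1 := abs_le.mpr ⟨by linarith [hs.1], hs.2⟩
  have : |s| * α₀ ≤ α₀ := by nlinarith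
  linarith [Real.exp_le_exp.mpr this]

/-- **THE CURL ALONG THE SEGMENT**: `‖(d_{V_s}A)(p′)‖ ≤ 2α₁ + 24(e^{α₀} − 1)α₀`. [folklore] -/
theorem norm_curlAt_vary_le_W [Nonempty n] {W : Site d → Fin d → (Matrix n n ℂ)ˣ} (hW : IsUnitaryCfg W) {A : Site d → Fin d → Matrix n n ℂ}
    (hA : IsSkewDir A) {α₀ α₁ : ℝ} (hAα : ∀ y κ, ‖A y κ‖ ≤ α₀)
    (hA1 : ∀ (y : Site d) (κ τ : Fin d), ‖Ad (W (y + e κ) τ) (A (y + e τ) κ) - A y κ‖ ≤ α₁)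
    {s : ℝ} (hs : s ∈ Icc (0 : ℝ) 1) (z : Site d) (μ ν : Fin d) :
    ‖curlAt (vary W A s) A z μ ν‖ ≤ 2 * α₁ + 24 * (Real.exp α₀ - 1) * α₀ := by
  have hα : 0 ≤ α₀ := (norm_nonneg _).trans (hAα z μ)
  have h := norm_curlAt_vary_sub_le hW hA hAα s A z μ ν
  have hb : bondL1At A z μ ν ≤ 4 * α₀ := bondL1At_le_of_sup hAα z μ ν
  have hb0 : 0 ≤ bondL1At A z μ ν := bondL1At_nonneg A z μ ν
  have hs1 : |s| ≤ 1 := abs_le.mpr ⟨by linarith [hs.1], hs.2⟩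
  have hexp : Real.exp (|s| * α₀) - 1 ≤ Real.exp α₀ - 1 := by
    have : |s| * α₀ ≤ α₀ := by nlinarith
    linarith [Real.exp_le_exp.mpr this]
  have hδ0 : 0 ≤ Real.exp (|s| * α₀) - 1 := by
    have : 0 ≤ |s| * α₀ := mul_nonneg (abs_nonneg s) hα
    linarith [Real.one_le_exp this]
  have h0 := norm_curlAt_le_of_covGrad hW hA1 z μ ν
  have htri : ‖curlAt (vary W A s) A z μ ν‖ ≤ ‖curlAt (vary W A s) A z μ ν - curlAt W A z μ ν‖ + ‖curlAt W A z μ ν‖ := by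
    have := norm_add_le (curlAt (vary W A s) A z μ ν - curlAt W A z μ ν) (curlAt W A z μ ν)
    simpa using this
  have hmid : 6 * (Real.exp (|s| * α₀) - 1) * bondL1At A z μ ν ≤ 24 * (Real.exp α₀ - 1) * α₀ := by
    calc 6 * (Real.exp (|s| * α₀) - 1) * bondL1At A z μ ν ≤ 6 * (Real.exp α₀ - 1) * (4 * α₀) :=
          mul_le_mul (mul_le_mul_of_nonneg_left hexp (by norm_num)) hb hb0 (by linarith)
      _ = 24 * (Real.exp α₀ - 1) * α₀ := by ring
  linarith

/-- **THE PLAQUETTE VARIABLE ALONG THE SEGMENT**: `‖V_s(∂p′) − W(∂p′)‖ ≤ 2α₁ + 24α₀(e^{α₀} − 1)` (row NE3's `norm_hol_vary_sub_hol_le_curl` + §1). [folklore] -/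
theorem norm_hol_vary_sub_hol_le_W [Nonempty n] {W : Site d → Fin d → (Matrix n n ℂ)ˣ} (hW : IsUnitaryCfg W) {A : Site d → Fin d → Matrix n n ℂ}
    (hA : IsSkewDir A) {α₀ α₁ : ℝ} (hAα : ∀ y κ, ‖A y κ‖ ≤ α₀)
    (hA1 : ∀ (y : Site d) (κ τ : Fin d), ‖Ad (W (y + e κ) τ) (A (y + e τ) κ) - A y κ‖ ≤ α₁)
    {s : ℝ} (hs : s ∈ Icc (0 : ℝ) 1) (z : Site d) (μ ν : Fin d) :
    ‖((hol (vary W A s) z (plaqWord μ ν) : (Matrix n n ℂ)ˣ) : Matrix n n ℂ) - ((hol W z (plaqWord μ ν) : (Matrix n n ℂ)ˣ) : Matrix n n ℂ)‖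
      ≤ 2 * α₁ + 24 * α₀ * (Real.exp α₀ - 1) := by
  have hα : 0 ≤ α₀ := (norm_nonneg _).trans (hAα z μ)
  have h := norm_hol_vary_sub_hol_le_curl hW hA hAα hs.1 z μ ν
  have h0 := norm_curlAt_le_of_covGrad hW hA1 z μ ν
  have hb : bondL1At A z μ ν ≤ 4 * α₀ := bondL1At_le_of_sup hAα z μ ν
  have hb0 : 0 ≤ bondL1At A z μ ν := bondL1At_nonneg A z μ ν
  have hexp : Real.exp (s * α₀) - 1 ≤ Real.exp α₀ - 1 := by
    have : s * α₀ ≤ α₀ := by nlinarith [hs.1, hs.2]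
    linarith [Real.exp_le_exp.mpr this]
  have hδ0 : 0 ≤ Real.exp (s * α₀) - 1 := by
    have : 0 ≤ s * α₀ := mul_nonneg hs.1 hα
    linarith [Real.one_le_exp this]
  have hin : ‖curlAt W A z μ ν‖ + 6 * (Real.exp (s * α₀) - 1) * bondL1At A z μ ν ≤ 2 * α₁ + 24 * α₀ * (Real.exp α₀ - 1) := by
    have : 6 * (Real.exp (s * α₀) - 1) * bondL1At A z μ ν ≤ 6 * (Real.exp α₀ - 1) * (4 * α₀) :=
      mul_le_mul (mul_le_mul_of_nonneg_left hexp (by norm_num)) hb hb0 (by linarith)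
    linarith
  have hpos : 0 ≤ ‖curlAt W A z μ ν‖ + 6 * (Real.exp (s * α₀) - 1) * bondL1At A z μ ν := by positivity
  calc _ ≤ s * (‖curlAt W A z μ ν‖ + 6 * (Real.exp (s * α₀) - 1) * bondL1At A z μ ν) := h
    _ ≤ 1 * (2 * α₁ + 24 * α₀ * (Real.exp α₀ - 1)) := mul_le_mul hs.2 hin hpos zero_le_one
    _ = 2 * α₁ + 24 * α₀ * (Real.exp α₀ - 1) := one_mul _

/-- **THE TAYLOR TAIL OF THE CURL ALONG THE SEGMENT AT A CURVED BACKGROUND**: `‖(d_{V_s}A)(p′) − (d_WA)(p′) − s·𝒬_W(A)(p′)‖ ≤ 960(e^{α₀} − 1)α₀²`,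
`𝒬_W(A) = dcurlAt W A A`, `s ∈ [0,1]` (mean value; the derivative `dcurlAt V_t A A − dcurlAt W A A` is `≤ 60(e^{α₀}−1)·bl₁(A)²` by F47). [folklore] -/
theorem norm_curlAt_vary_taylor_le_W [Nonempty n] {W : Site d → Fin d → (Matrix n n ℂ)ˣ} (hW : IsUnitaryCfg W) {A : Site d → Fin d → Matrix n n ℂ}
    (hA : IsSkewDir A) {α₀ : ℝ} (hAα : ∀ y κ, ‖A y κ‖ ≤ α₀) {s : ℝ} (hs : s ∈ Icc (0 : ℝ) 1) (z : Site d) (μ ν : Fin d) :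
    ‖curlAt (vary W A s) A z μ ν - curlAt W A z μ ν - s • dcurlAt W A A z μ ν‖ ≤ 960 * (Real.exp α₀ - 1) * α₀ ^ 2 := by
  have hα : 0 ≤ α₀ := (norm_nonneg _).trans (hAα z μ)
  set Q : Matrix n n ℂ := dcurlAt W A A z μ ν with hQ
  set f : ℝ → Matrix n n ℂ := fun t => curlAt (vary W A t) A z μ ν - t • Q with hf
  have hfd : ∀ t : ℝ, HasDerivAt f (dcurlAt (vary W A t) A A z μ ν - Q) t := by
    intro t
    have h1 := hasDerivAt_curlAt_vary_at W A A z μ ν t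
    have h2 : HasDerivAt (fun t : ℝ => t • Q) ((1 : ℝ) • Q) t := (hasDerivAt_id t).smul_const Q
    rw [one_smul] at h2
    exact h1.sub h2
  have hδ : 0 ≤ Real.exp α₀ - 1 := by linarith [Real.one_le_exp hα]
  have hbd : ∀ t ∈ Ico (0 : ℝ) 1, ‖dcurlAt (vary W A t) A A z μ ν - Q‖ ≤ 960 * (Real.exp α₀ - 1) * α₀ ^ 2 := by
    intro t ht
    have ht' : t ∈ Icc (0 : ℝ) 1 := ⟨ht.1, ht.2.le⟩
    have hl := fun x κ => norm_vary_sub_le_W hW hAα ht' x κ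
    have h := norm_dcurlAt_sub_dcurlAt_le hW (vary_isUnitaryCfg hW hA t) A A z μ ν (hl z μ) (hl (z + e μ) ν) (hl (z + e ν) μ)
    have hb : bondL1At A z μ ν ≤ 4 * α₀ := bondL1At_le_of_sup hAα z μ ν
    have hb0 : 0 ≤ bondL1At A z μ ν := bondL1At_nonneg A z μ ν
    have hsq : bondL1At A z μ ν * bondL1At A z μ ν ≤ (4 * α₀) * (4 * α₀) := mul_le_mul hb hb hb0 (by positivity)
    rw [hQ]
    calc ‖dcurlAt (vary W A t) A A z μ ν - dcurlAt W A A z μ ν‖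
        ≤ 60 * (Real.exp α₀ - 1) * (bondL1At A z μ ν * bondL1At A z μ ν) := h
      _ ≤ 60 * (Real.exp α₀ - 1) * ((4 * α₀) * (4 * α₀)) := mul_le_mul_of_nonneg_left hsq (by positivity)
      _ = 960 * (Real.exp α₀ - 1) * α₀ ^ 2 := by ring
  have hmv := norm_image_sub_le_of_norm_deriv_le_segment' (f := f) (a := 0) (b := 1)
    (fun t _ => (hfd t).hasDerivWithinAt) hbd s hs
  have hf0 : f 0 = curlAt W A z μ ν := by simp [hf, vary_zero]
  have hfs : f s - f 0 = curlAt (vary W A s) A z μ ν - curlAt W A z μ ν - s • Q := by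
    rw [hf0]; simp only [hf]; abel
  rw [← hfs]
  refine hmv.trans ?_
  have : 960 * (Real.exp α₀ - 1) * α₀ ^ 2 * (s - 0) ≤ 960 * (Real.exp α₀ - 1) * α₀ ^ 2 * 1 :=
    mul_le_mul_of_nonneg_left (by linarith [hs.2]) (by positivity)
  linarith

/-- `𝒬_W(A) = dcurlAt W A A` is `P`-periodic in the corner for `P`-periodic `W`, `A` (translation covariance, F62 `dcurlAt_shift`). [folklore] -/
theorem dcurlAt_self_periodic_W {P : ℤ} {W : Site d → Fin d → (Matrix n n ℂ)ˣ} (hWP : IsPeriodicCfg W P) {A : Site d → Fin d → Matrix n n ℂ}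
    (hAP : IsPeriodicDir A P) (z : Site d) (κ μ ν : Fin d) :
    dcurlAt W A A (z + P • e κ) μ ν = dcurlAt W A A z μ ν := by
  have hW' : (fun (y : Site d) (κ' : Fin d) => W (y - (-(P • e κ))) κ') = W := by
    funext y κ'; simp only [sub_neg_eq_add]; exact hWP y κ κ'
  have hA' : (fun (y : Site d) (κ' : Fin d) => A (y - (-(P • e κ))) κ') = A := by
    funext y κ'; simp only [sub_neg_eq_add]; exact hAP y κ κ'
  have h := dcurlAt_shift W A A (-(P • e κ)) z μ ν
  rw [hW', hA', sub_neg_eq_add] at h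
  exact h.symm

end

end Summit.QuantumFields.BalabanUV.T4Continuum.NE7ExpansionSegmentLettersCurved
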